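import Literature.NumberTheory.EllipticCurves.GreenbergVatsal2000.GreenbergSelmerGroups
import Literature.NumberTheory.EllipticCurves.ZpExtensionRestrictCyclotomic
import Literature.NumberTheory.EllipticCurves.SubgroupSelmerCocycleCriteriaProofs
import Literature.NumberTheory.EllipticCurves.PeriodIndexCorestrictionLocal
import Literature.NumberTheory.GaloisRepresentations.AbsGaloisOuterConj
import Literature.NumberTheory.GaloisRepresentations.IntegralGaloisActionProofs
import HarnessLib

/-!
# Crux `MazurMCOnX1RankZero` (item stmt-BirchSwinnertonDyer-19035), line `interlude_with_torsion`, road B (B3):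
# the OUTER action of `Γ_ℚ` on `H¹(K_∞, M)` for a module with `Γ_ℚ`-provenance (helper 1 of 3)

Cell `bsd-eis` (host `run/shared/lean/pub/bsd-eis/`), LEAD `cruxlead-19035` (g0), stub worker on the registered stub
`stub_residualGL1FinitenessOdd : ResidualGL1FinitenessOdd` of skeleton v8 (`Cruxes/MazurMCOnX1RankZero/Lines/
interlude_with_torsion.lean`); `--supports` stmt-BirchSwinnertonDyer-19035 as a HELPER.  The stub asks that Greenberg's
residual Selmer group of an order-`p` module `M` over the CYCLOTOMIC `ℤ_p`-extension `K_∞` of an imaginary quadratic `K`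
(`p = v v̄` odd split; no condition above `v`, strict above `v̄`) be finite WHEN the `Γ_K`-action on `M` is restricted
from a `Γ_ℚ`-action (`σ • m = (absGaloisRestrict ℚ K σ) • m`).  Greenberg's mechanism (LNM 1716, §5, Lemma 5.9 and the
proof of Prop. 5.10) runs over `ℚ_∞`; the bridge `K_∞ ↔ ℚ_∞` is the action of `Gal(K_∞/ℚ_∞) = ⟨c⟩` on `H¹(K_∞, M)`,
which SWAPS the conditions above `v` and `v̄`.  This file builds that action in the tree's Galois-cohomology model
(`subgroupH1`, `resH1Hom`, `conjH1` of `SubgroupSelmer`; `absGaloisOuterConj` = the outer action `θ_τ` of `Γ_ℚ` on `Γ_K`):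

* `outerConjSubgroup`, **`outerConjH1 H hH M hM τ : H¹(H, M) →+ H¹(H, M)`** — for `L/F` Galois, `H ≤ Γ_L` stable under
  every `θ_τ` (`τ ∈ Γ_F`) and a discrete `Γ_F`-module `M` on which `Γ_L` acts through `res`, the map of the compatible pair
  `(θ_{τ⁻¹}|_H, m ↦ τ • m)`; on cocycles `(τ · z)(x) = τ • z(θ_{τ⁻¹} x)` (`outerConjH1_oneCocycleClass`); kernel criterion
  `resOfLe_outerConjH1_oneCocycleClass_eq_zero_iff`.
* `resOfLe_conjH1_eq_zero_iff`, **`forall_resOfLe_conjH1_eq_zero_iff`** — "every `Γ_L`-conjugate of `c` dies on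
  `H ⊓ J(𝔓₀)`" iff "`c` dies on `H ⊓ J(𝔓)` for EVERY prime `𝔓` above the place" (`J` = inertia or decomposition group;
  transitivity of `Γ_L` on the primes above a place), and **`resOfLe_outerConjH1_eq_zero`** — the outer action of `τ`
  carries the latter condition at `w` to the same condition at `τ̄ • w` (`θ_τ I_𝔔 = I_{τ ⋆ 𝔔}`, `τ ⋆ 𝔔 ∣ τ̄ • w`).
* `absGaloisOuterConj_mem_kerSubgroup` — `Gal(K̄/K_∞^{cyc})` is `Γ_ℚ`-stable (`χ_{p,K} = χ_{p,ℚ} ∘ res`), whence the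
  **swap `cycSwapH1 κ hκ M hM τ`** on `H¹(K_∞^{cyc}, M)`.

HONEST FRAMING.  Bookkeeping in continuous group cohomology; three definitions with bodies and proved API; no named
fact, no `sorry`; nothing about BSD, Mazur's main conjecture or IMC2 is asserted.  Companions: `…InterludeResidualGL1Swap`
(the swap permutes the Greenberg conditions; the core reduction at `S = ∅`) and `…InterludeResidualGL1Finiteness` (the
stub's statement from three displayed inputs).

References: R. Greenberg, LNM 1716 (1999), §5, Lemma 5.9 and proof of Prop. 5.10 [GreenbergLNM1716]; J.-P. Serre, *Galois
Cohomology* I §2.4–2.5, §5.1 [SerreGaloisCohomology1997]; J. Neukirch, *Algebraic Number Theory* I §9, II §9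
[NeukirchANT1999]; L. Washington, *Introduction to Cyclotomic Fields* §13.1 [Washington1997].
-/

set_option linter.dupNamespace false
set_option autoImplicit false

noncomputable section

open scoped Classical Pointwise

namespace Summit.BirchSwinnertonDyer.BirchSwinnertonDyer.Theorems.InterludeWithTorsion

open NumberField IsDedekindDomain Field
open Literature.NumberTheory.EllipticCurves Literature.NumberTheory.EllipticCurves.GreenbergSelmer
  Literature.NumberTheory.EllipticCurves.GreenbergVatsal2000 Literature.NumberTheory.GaloisRepresentations

/-! ## §1 The outer action of `Γ_F` on `H¹(H, M)` for `H ≤ Γ_L` stable and `M` a `Γ_F`-module -/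

section OuterConj

variable {F L : Type} [Field F] [Field L] [NumberField L] [Algebra F L] [IsGalois F L]
variable (H : Subgroup (absoluteGaloisGroup L))
  (hH : ∀ (τ : absoluteGaloisGroup F) (x : absoluteGaloisGroup L), x ∈ H → absGaloisOuterConj F L τ x ∈ H)
variable (M : Type) [AddCommGroup M] [DistribMulAction (absoluteGaloisGroup F) M]
  [DistribMulAction (absoluteGaloisGroup L) M] [TopologicalSpace M] [DiscreteTopology M]
  (hM : ∀ (σ : absoluteGaloisGroup L) (m : M), σ • m = absGaloisRestrict F L σ • m)

/-- The outer automorphism `θ_{τ⁻¹} = res⁻¹(τ⁻¹ · res(·) · τ)` of `Γ_L` (`absGaloisOuterConj`) restricted to a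
`Γ_F`-stable subgroup `H ≤ Γ_L`, as a continuous endomorphism of `H` (the variance `τ⁻¹` makes
`(θ_{τ⁻¹}, m ↦ τ • m)` a compatible pair, as for `subgroupConj`). [folklore] -/
def outerConjSubgroup (τ : absoluteGaloisGroup F) : H →ₜ* H where
  toFun x := ⟨absGaloisOuterConj F L τ⁻¹ x, hH τ⁻¹ x x.2⟩
  map_one' := Subtype.ext (map_one _)
  map_mul' _ _ := Subtype.ext (map_mul _ _ _)
  continuous_toFun := ((absGaloisOuterConj F L τ⁻¹).continuous.comp continuous_subtype_val).subtype_mk _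

/-- Unfolding `outerConjSubgroup`. [folklore] -/
@[simp] theorem outerConjSubgroup_apply_coe (τ : absoluteGaloisGroup F) (x : H) :
    ((outerConjSubgroup H hH τ x : H) : absoluteGaloisGroup L) = absGaloisOuterConj F L τ⁻¹ x := rfl

include hM

omit [TopologicalSpace M] [DiscreteTopology M] in
/-- Compatibility of the pair `(θ_{τ⁻¹}|_H, m ↦ τ • m)` when `Γ_L` acts on `M` through `res : Γ_L → Γ_F`:
`τ • (θ_{τ⁻¹}(x) • m) = x • (τ • m)`. [folklore] -/
theorem outerConj_compat (τ : absoluteGaloisGroup F) (x : H) (m : M) :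
    DistribSMul.toAddMonoidHom M τ (outerConjSubgroup H hH τ x • m) =
      x • DistribSMul.toAddMonoidHom M τ m := by
  simp only [DistribSMul.toAddMonoidHom_apply, Subgroup.smul_def]
  rw [outerConjSubgroup_apply_coe, hM, hM, absGaloisRestrict_absGaloisOuterConj, inv_inv, smul_smul,
    smul_smul]
  congr 1
  group

/-- **The outer action of `τ ∈ Γ_F` on `H¹(H, M)`** for a `Γ_F`-stable subgroup `H ≤ Γ_L` (`L/F` Galois) and a
discrete `Γ_F`-module `M` on which `Γ_L` acts through `res`: the map of the compatible pair
`(θ_{τ⁻¹}|_H, m ↦ τ • m)`; on cocycles `(τ · z)(x) = τ • z(θ_{τ⁻¹} x)`.  For `τ = res σ₀` it is the usual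
conjugation `conjH1 H M σ₀` (Serre's action of `G/H` on `H¹(H, M)`), so this is the action of
`Gal(K̄^H/F) ⊇ Gal(K̄^H/L)` when `K̄^H/F` is Galois. [cite: SerreGaloisCohomology1997, I §2.5] -/
def outerConjH1 (τ : absoluteGaloisGroup F) : subgroupH1 H M →+ subgroupH1 H M :=
  resH1Hom (outerConjSubgroup H hH τ) (DistribSMul.toAddMonoidHom M τ) (outerConj_compat H hH M hM τ)

/-- `outerConjH1` on an explicit class: `τ · [z] = [x ↦ τ • z(θ_{τ⁻¹} x)]`. [cite: SerreGaloisCohomology1997, I §2.4] -/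
theorem outerConjH1_oneCocycleClass (τ : absoluteGaloisGroup F) (z : contOneCocycles (discreteTopRep H M)) :
    outerConjH1 H hH M hM τ (oneCocycleClass _ z) =
      oneCocycleClass _ (contOneCocycles.pullback (outerConjSubgroup H hH τ)
        (resHomOfEquivariant _ _ (outerConj_compat H hH M hM τ)) z) :=
  resH1Hom_oneCocycleClass _ _ _ z

/-- Values of the outer-conjugated cocycle. [folklore] -/
theorem outerConj_pullback_apply (τ : absoluteGaloisGroup F) (z : contOneCocycles (discreteTopRep H M)) (x : H) :
    (contOneCocycles.pullback (outerConjSubgroup H hH τ)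
        (resHomOfEquivariant _ _ (outerConj_compat H hH M hM τ)) z).1 x =
      τ • z.1 (outerConjSubgroup H hH τ x) :=
  rfl

/-- **Kernel criterion after outer conjugation**: for `H₁ ≤ H`, `res_{H₁} (τ · [z]) = 0` iff
`x ↦ τ • z(θ_{τ⁻¹} x)` is principal on `H₁`. [cite: SerreGaloisCohomology1997, I §5.1] -/
theorem resOfLe_outerConjH1_oneCocycleClass_eq_zero_iff {H₁ : Subgroup (absoluteGaloisGroup L)} (hle : H₁ ≤ H)
    (τ : absoluteGaloisGroup F) (z : contOneCocycles (discreteTopRep H M)) :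
    resOfLe M hle (outerConjH1 H hH M hM τ (oneCocycleClass _ z)) = 0 ↔
      ∃ a : M, ∀ x : H₁, τ • z.1 (outerConjSubgroup H hH τ (Subgroup.inclusion hle x)) =
        (x : absoluteGaloisGroup L) • a - a := by
  rw [outerConjH1_oneCocycleClass, CocycleCriteria.resOfLe_oneCocycleClass_eq_zero_iff]
  rfl

end OuterConj

/-! ## §2 Classes dying on `H ⊓ J(𝔓)` for every prime `𝔓` above a place: conjugates versus primes -/

section Primes

variable {F L : Type} [Field F] [Field L] [NumberField L] [Algebra F L] [IsGalois F L]
variable (H : Subgroup (absoluteGaloisGroup L))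
variable (M : Type) [AddCommGroup M] [DistribMulAction (absoluteGaloisGroup F) M]
  [DistribMulAction (absoluteGaloisGroup L) M] [TopologicalSpace M] [DiscreteTopology M]

omit [NumberField L] [IsGalois F L] in
/-- Cocycle criterion: `res_{H ⊓ J} [z] = 0` iff `z` is principal on `H ⊓ J`.
[cite: SerreGaloisCohomology1997, I §5.1] -/
theorem resOfLe_inf_oneCocycleClass_eq_zero_iff (J : Subgroup (absoluteGaloisGroup L))
    (z : contOneCocycles (discreteTopRep H M)) :
    resOfLe M (inf_le_left : H ⊓ J ≤ H) (oneCocycleClass _ z) = 0 ↔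
      ∃ a : M, ∀ (x : absoluteGaloisGroup L) (hx : x ∈ H), x ∈ J → z.1 ⟨x, hx⟩ = x • a - a := by
  rw [CocycleCriteria.resOfLe_oneCocycleClass_eq_zero_iff]
  constructor
  · rintro ⟨a, ha⟩
    exact ⟨a, fun x hx hxJ ↦ ha ⟨x, Subgroup.mem_inf.mpr ⟨hx, hxJ⟩⟩⟩
  · rintro ⟨a, ha⟩
    exact ⟨a, fun x ↦ ha x (Subgroup.mem_inf.mp x.2).1 (Subgroup.mem_inf.mp x.2).2⟩

omit [NumberField L] [IsGalois F L] in
/-- **Conjugation moves the subgroup**: for `H` normal, `σ ∈ Γ_L` and subgroups `J, J'` with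
`J' = σ⁻¹ J σ`, `res_{H ⊓ J} (conj_σ c) = 0 ↔ res_{H ⊓ J'} c = 0` (on cocycles:
`σ • z(σ⁻¹ x σ) = x • a - a` on `J` iff `z(y) = y • σ⁻¹a - σ⁻¹a` on `J'`).
[cite: SerreGaloisCohomology1997, I §2.5] [cite: NeukirchANT1999, Ch. I §9 Prop. (9.4)] -/
theorem resOfLe_conjH1_eq_zero_iff [H.Normal] {J J' : Subgroup (absoluteGaloisGroup L)}
    (σ : absoluteGaloisGroup L) (hJ : ∀ g : absoluteGaloisGroup L, g ∈ J' ↔ σ * g * σ⁻¹ ∈ J)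
    (c : subgroupH1 H M) :
    resOfLe M (inf_le_left : H ⊓ J ≤ H) (conjH1 H M σ c) = 0 ↔
      resOfLe M (inf_le_left : H ⊓ J' ≤ H) c = 0 := by
  obtain ⟨z, rfl⟩ := oneCocycleClass_surjective _ c
  rw [CocycleCriteria.conjH1_oneCocycleClass_mem_ker_resOfLe_iff, resOfLe_inf_oneCocycleClass_eq_zero_iff]
  constructor
  · rintro ⟨a, ha⟩
    refine ⟨σ⁻¹ • a, fun y hy hyJ ↦ ?_⟩
    have hxH : σ * y * σ⁻¹ ∈ H := ‹H.Normal›.conj_mem y hy σ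
    have hxJ : σ * y * σ⁻¹ ∈ J := (hJ y).mp hyJ
    have key := ha ⟨σ * y * σ⁻¹, Subgroup.mem_inf.mpr ⟨hxH, hxJ⟩⟩
    have e : subgroupConj H σ (Subgroup.inclusion inf_le_left
        (⟨σ * y * σ⁻¹, Subgroup.mem_inf.mpr ⟨hxH, hxJ⟩⟩ : ↥(H ⊓ J))) = (⟨y, hy⟩ : H) := by
      apply Subtype.ext
      rw [subgroupConj_apply_coe]
      change σ⁻¹ * (σ * y * σ⁻¹) * σ = y
      group
    rw [e] at key
    change σ • z.1 ⟨y, hy⟩ = (σ * y * σ⁻¹) • a - a at key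
    have key' := congrArg (fun m : M ↦ σ⁻¹ • m) key
    dsimp only at key'
    rw [inv_smul_smul, smul_sub, smul_smul] at key'
    rw [key', smul_smul]
    congr 2
    group
  · rintro ⟨b, hb⟩
    refine ⟨σ • b, fun x ↦ ?_⟩
    have hxH : ((x : absoluteGaloisGroup L)) ∈ H := (Subgroup.mem_inf.mp x.2).1
    have hxJ : ((x : absoluteGaloisGroup L)) ∈ J := (Subgroup.mem_inf.mp x.2).2
    have hyH : σ⁻¹ * x * σ ∈ H := by
      have := ‹H.Normal›.conj_mem _ hxH σ⁻¹
      rwa [inv_inv] at this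
    have hyJ : σ⁻¹ * x * σ ∈ J' := by
      rw [hJ, show σ * (σ⁻¹ * x * σ) * σ⁻¹ = x by group]
      exact hxJ
    have e : subgroupConj H σ (Subgroup.inclusion inf_le_left x) = (⟨σ⁻¹ * x * σ, hyH⟩ : H) :=
      Subtype.ext (subgroupConj_apply_coe H σ _)
    rw [e, hb _ hyH hyJ, smul_sub, smul_smul, smul_smul]
    congr 2
    group

/-- **All conjugates die on `H ⊓ J(𝔓₀)` iff the class dies on `H ⊓ J(𝔓)` for EVERY prime `𝔓` above
the place** (`𝔓₀` a prime above `w`, `J(σ • 𝔓) = σ J(𝔓) σ⁻¹`, `Γ_L` transitive on the primes above `w`).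
[cite: NeukirchANT1999, Ch. I §9 Prop. (9.1), (9.4)] -/
theorem forall_resOfLe_conjH1_eq_zero_iff [H.Normal]
    (J : Ideal (absIntegers (𝓞 L) L) → Subgroup (absoluteGaloisGroup L))
    (hJσ : ∀ (σ : absoluteGaloisGroup L) (𝔓 : Ideal (absIntegers (𝓞 L) L)) (g : absoluteGaloisGroup L),
      g ∈ J (σ • 𝔓) ↔ σ⁻¹ * g * σ ∈ J 𝔓)
    {w : HeightOneSpectrum (𝓞 L)} {𝔓₀ : Ideal (absIntegers (𝓞 L) L)} (h𝔓₀ : 𝔓₀ ∈ w.primesAbove)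
    (c : subgroupH1 H M) :
    (∀ σ : absoluteGaloisGroup L, resOfLe M (inf_le_left : H ⊓ J 𝔓₀ ≤ H) (conjH1 H M σ c) = 0) ↔
      ∀ 𝔓 ∈ w.primesAbove, resOfLe M (inf_le_left : H ⊓ J 𝔓 ≤ H) c = 0 := by
  have hJ' : ∀ σ g : absoluteGaloisGroup L, g ∈ J (σ⁻¹ • 𝔓₀) ↔ σ * g * σ⁻¹ ∈ J 𝔓₀ := fun σ g ↦ by
    rw [hJσ, inv_inv]
  constructor
  · intro h 𝔓 h𝔓
    obtain ⟨ρ, hρ⟩ := HeightOneSpectrum.exists_smul_eq_of_mem_primesAbove_holds h𝔓₀ h𝔓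
    have h1 := (resOfLe_conjH1_eq_zero_iff H M ρ⁻¹ (hJ' ρ⁻¹) c).mp (h ρ⁻¹)
    rwa [inv_inv, hρ] at h1
  · intro h σ
    exact (resOfLe_conjH1_eq_zero_iff H M σ (hJ' σ) c).mpr (h _ (smul_mem_primesAbove h𝔓₀ σ⁻¹))

variable (hH : ∀ (τ : absoluteGaloisGroup F) (x : absoluteGaloisGroup L), x ∈ H → absGaloisOuterConj F L τ x ∈ H)
  (hM : ∀ (σ : absoluteGaloisGroup L) (m : M), σ • m = absGaloisRestrict F L σ • m)

include hM in
/-- **Outer conjugation transports the vanishing to the conjugate place**: if `c` dies on `H ⊓ J(𝔔)` for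
every prime `𝔔` above `w`, then `τ · c` dies on `H ⊓ J(𝔓)` for every prime `𝔓` above `τ̄ • w`
(`θ_{τ⁻¹} J(𝔓) = J(τ⁻¹ ⋆ 𝔓)`, `τ⁻¹ ⋆ 𝔓 ∣ τ̄⁻¹ τ̄ w = w`). [cite: NeukirchANT1999, Ch. I §9 Prop. (9.4)] -/
theorem resOfLe_outerConjH1_eq_zero (J : Ideal (absIntegers (𝓞 L) L) → Subgroup (absoluteGaloisGroup L))
    (hJτ : ∀ (τ : absoluteGaloisGroup F) (𝔔 : Ideal (absIntegers (𝓞 L) L)) (g : absoluteGaloisGroup L),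
      absGaloisOuterConj F L τ g ∈ J (outerConjIdeal τ 𝔔) ↔ g ∈ J 𝔔)
    (τ : absoluteGaloisGroup F) {w : HeightOneSpectrum (𝓞 L)} (c : subgroupH1 H M)
    (hc : ∀ 𝔔 ∈ w.primesAbove, resOfLe M (inf_le_left : H ⊓ J 𝔔 ≤ H) c = 0)
    {𝔓 : Ideal (absIntegers (𝓞 L) L)} (h𝔓 : 𝔓 ∈ (absGaloisQuot F L τ • w).primesAbove) :
    resOfLe M (inf_le_left : H ⊓ J 𝔓 ≤ H) (outerConjH1 H hH M hM τ c) = 0 := by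
  obtain ⟨z, rfl⟩ := oneCocycleClass_surjective _ c
  -- `𝔔 = τ⁻¹ ⋆ 𝔓` lies above `w`
  have h𝔔 : outerConjIdeal τ⁻¹ 𝔓 ∈ w.primesAbove := by
    have := outerConjIdeal_mem_primesAbove h𝔓 τ⁻¹
    rwa [map_inv, inv_smul_smul] at this
  obtain ⟨b, hb⟩ := (resOfLe_inf_oneCocycleClass_eq_zero_iff H M _ z).mp (hc _ h𝔔)
  rw [resOfLe_outerConjH1_oneCocycleClass_eq_zero_iff]
  refine ⟨τ • b, fun x ↦ ?_⟩
  have hxH : ((x : absoluteGaloisGroup L)) ∈ H := (Subgroup.mem_inf.mp x.2).1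
  have hxJ : ((x : absoluteGaloisGroup L)) ∈ J 𝔓 := (Subgroup.mem_inf.mp x.2).2
  have hyH : absGaloisOuterConj F L τ⁻¹ x ∈ H := hH τ⁻¹ x hxH
  have hyJ : absGaloisOuterConj F L τ⁻¹ x ∈ J (outerConjIdeal τ⁻¹ 𝔓) := (hJτ τ⁻¹ 𝔓 x).mpr hxJ
  have e : outerConjSubgroup H hH τ (Subgroup.inclusion inf_le_left x) =
      (⟨absGaloisOuterConj F L τ⁻¹ x, hyH⟩ : H) := Subtype.ext rfl
  rw [e, hb _ hyH hyJ, smul_sub, hM, smul_smul, absGaloisRestrict_absGaloisOuterConj, inv_inv,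
    hM (x : absoluteGaloisGroup L), smul_smul]
  congr 2
  group

end Primes

/-! ## §5 The cyclotomic tower is `Γ_ℚ`-stable; the swap on `H¹(K_∞, M)` -/

section Cyclotomic

variable {K : Type} [Field K] [NumberField K] [IsGalois ℚ K] {p : ℕ} [Fact p.Prime]

/-- **`Gal(K̄/K_∞^{cyc})` is stable under the outer action of `Γ_ℚ`** (`K_∞^{cyc} = K·ℚ_∞` is Galois over `ℚ`):
`ker κ = χ_{p,K}⁻¹(μ(ℤ_p))` (`ZpExtension.IsCyclotomic`), `χ_{p,K} = χ_{p,ℚ} ∘ res` (`cyclotomicCharacter_absGaloisRestrict`)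
and `ℤ_pˣ` is commutative. [cite: Washington1997, §13.1] -/
theorem absGaloisOuterConj_mem_kerSubgroup (κ : ZpExtension K p) (hκ : κ.IsCyclotomic)
    (τ : absoluteGaloisGroup ℚ) (x : absoluteGaloisGroup K) (hx : x ∈ κ.kerSubgroup) :
    absGaloisOuterConj ℚ K τ x ∈ κ.kerSubgroup := by
  haveI : NeZero (p : ℚ) := ⟨Nat.cast_ne_zero.mpr (Fact.out : p.Prime).ne_zero⟩
  have h : κ.kerSubgroup =
      (CommGroup.torsion ℤ_[p]ˣ).comap (GaloisRep.cyclotomicCharacter K p).toMonoidHom := hκ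
  rw [h, Subgroup.mem_comap] at hx ⊢
  change GaloisRep.cyclotomicCharacter K p (absGaloisOuterConj ℚ K τ x) ∈ CommGroup.torsion ℤ_[p]ˣ
  change GaloisRep.cyclotomicCharacter K p x ∈ CommGroup.torsion ℤ_[p]ˣ at hx
  rw [← cyclotomicCharacter_absGaloisRestrict ℚ K p, absGaloisRestrict_absGaloisOuterConj, map_mul, map_mul,
    map_inv, mul_comm (GaloisRep.cyclotomicCharacter ℚ p τ), mul_assoc, mul_inv_cancel, mul_one,
    cyclotomicCharacter_absGaloisRestrict ℚ K p]
  exact hx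

variable (κ : ZpExtension K p) (hκ : κ.IsCyclotomic)
variable (M : Type) [AddCommGroup M] [DistribMulAction (absoluteGaloisGroup ℚ) M]
  [DistribMulAction (absoluteGaloisGroup K) M] [TopologicalSpace M] [DiscreteTopology M]
  (hM : ∀ (σ : absoluteGaloisGroup K) (m : M), σ • m = absGaloisRestrict ℚ K σ • m)

/-- **The swap `T_τ` on `H¹(K_∞, M)`** (`K_∞ = K̄^{ker κ}` the cyclotomic tower, `M` a `Γ_ℚ`-module restricted to
`Γ_K`, `τ ∈ Γ_ℚ`): the outer action `outerConjH1` of `τ` on `H¹(ker κ, M)`.  For `τ ∉ res(Γ_K)` (`τ̄ ≠ 1` in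
`Gal(K/ℚ)`) it swaps the Greenberg conditions above `v` and `v̄ = τ̄ • v`; for `τ` a complex conjugation it is
the involution whose `±1`-parts are `H¹(ℚ_∞, M)` and `H¹(ℚ_∞, M ⊗ ε_K)` (inflation–restriction along `K_∞/ℚ_∞`).
[cite: GreenbergLNM1716, §5, proof of Lemma 5.9 («The restriction map … is an isomorphism»)] -/
def cycSwapH1 (τ : absoluteGaloisGroup ℚ) : subgroupH1 κ.kerSubgroup M →+ subgroupH1 κ.kerSubgroup M :=
  outerConjH1 κ.kerSubgroup (absGaloisOuterConj_mem_kerSubgroup κ hκ) M hM τ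

/-- Unfolding `cycSwapH1` (definitional). [folklore] -/
theorem cycSwapH1_eq (τ : absoluteGaloisGroup ℚ) :
    cycSwapH1 κ hκ M hM τ = outerConjH1 κ.kerSubgroup (absGaloisOuterConj_mem_kerSubgroup κ hκ) M hM τ := rfl

end Cyclotomic

end Summit.BirchSwinnertonDyer.BirchSwinnertonDyer.Theorems.InterludeWithTorsion

end
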